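/-
Fleet lead `ym-wcr-19609-p1` (seat prover-ym-wcr-19609-p1-g2-0), route `WeakCouplingRates`, crux `BulkDominatesColdBoxW`
(stmt-QuantumFields-19609), line `dlr-chessboard` (v6): UNITS of the mean shift — `qObsD` (Dirichlet units, scaled datum `sdat`) vs the interfaces' `F̄` (unscaled).
-/
import Summits.QuantumFields.YangMills.Theorems.WeakCouplingRatesColdBoxOneScaleDatumDefs
import Summits.QuantumFields.YangMills.Theorems.WeakCouplingRatesBulkDominatesColdBoxWDatumShiftIntegral
import Summits.QuantumFields.YangMills.Theorems.WeakCouplingRatesColdBoxDirichletShiftedMean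

/-!
# Crux `BulkDominatesColdBoxW`, expansion stubs: the units dictionary between `qObsD` and the interfaces

The assembler's cores (`abs_kernelMean_sub_gaussian_le_core₂`, `abs_kernelCov_sub_gaussian_le_moments`) take the quadratic surrogate in the form
`½Σ_c (F_c + dirCirc H p (t_c))²`; the ϑ-pass object is `qObsD H β ϑ p t = ½Σ_c (sCirc (glue ϑ'_c (mean ϑ'_c + t_c)) p)²` with the SCALED datum
`ϑ' = sdat β ϑ = √(2β)•ϑ` (`…ColdBoxOneScaleDatumDefs`, seat ym-wcr-19608-p2); the interfaces `KernelMeanExpansion` / `KernelCovExpansion` speak of the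
UNSCALED background `F̄_c(p) = sCirc (glue ϑ_c (mean ϑ_c)) p`.  Dictionary:
* `sCirc_smul'` — `sCirc (c•A) p = c · sCirc A p`;
* `dirBackground_sdat_eq` — `sCirc (glue ϑ'_c (mean ϑ'_c)) p = √(2β) · F̄_c(p)` (`glue_smul`, `mean_smul`, seat lead p465976);
* `qObsD_eq_half_sum_sq` — `qObsD H β ϑ p t = ½Σ_c (√(2β)F̄_c(p) + dirCirc H p (t_c))²` (affine split `sCirc_glue_add_ofLp`, seat ym-spine-20043-p1);
* `half_sum_sq_sdat_shift_eq`, `sum_sdat_shift_mul_eq` — `½Σ_c(√(2β)F̄_c)² = β·ΣF̄_c²` and `Σ_c (√(2β)F̄_c(p))(√(2β)F̄_c(q)) = 2β·ΣF̄_c(p)F̄_c(q)` (`β ≥ 0`):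
  the constant terms of the cores ARE the interface's `β·Σ_c F̄_c(x)²` and `2β(Σ_c F̄_c(p)F̄_c(q))·C_D`.
No new definition; standard axioms.  NOT a claim about the mass gap.
-/

set_option autoImplicit false

noncomputable section

open Finset
open Literature.Probability.LatticeModels Literature.MathematicalPhysics.QuantumLattice
open Literature.MathematicalPhysics.QuantumFieldTheory Literature.MathematicalPhysics.QuantumFieldTheory.LatticeMaxwell

namespace Summit.QuantumFields.YangMills.Theorems.WeakCouplingRates

variable {H : ℕ}

/-- The linear circulation is linear: `sCirc (c•A) p = c · sCirc A p`. -/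
theorem sCirc_smul' (c : ℝ) (A : Literature.MathematicalPhysics.QuantumLattice.ZdEdge 4 → ℝ) (p : Plaq 4) :
    sCirc (c • A) p = c * sCirc A p := by
  simp only [sCirc, Pi.smul_apply, smul_eq_mul]; ring

/-- **The background of the scaled datum is `√(2β)` times the background of the datum.** -/
theorem dirBackground_sdat_eq (β : ℝ) (ϑ : Fin 3 → Literature.MathematicalPhysics.QuantumLattice.ZdEdge 4 → ℝ) (c : Fin 3) (p : Plaq 4) :
    sCirc (glue (pin := fun e => e ∉ dirFreeEdges H) dirCorner (2 * H + 3) (sdat β ϑ c)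
        (mean (fun e => e ∉ dirFreeEdges H) dirCorner (2 * H + 3) (sdat β ϑ c))) p =
      Real.sqrt (2 * β) * sCirc (glue (pin := fun e => e ∉ dirFreeEdges H) dirCorner (2 * H + 3) (ϑ c)
        (mean (fun e => e ∉ dirFreeEdges H) dirCorner (2 * H + 3) (ϑ c))) p := by
  have hs : sdat β ϑ c = Real.sqrt (2 * β) • ϑ c := rfl
  rw [hs, mean_smul, ← sCirc_smul']
  congr 1
  funext e
  rw [glue_smul]; rfl

/-- **`qObsD` in the cores' form**: `qObsD H β ϑ p t = ½Σ_c (√(2β)·F̄_c(p) + dirCirc H p (t_c))²`. -/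
theorem qObsD_eq_half_sum_sq (β : ℝ) (ϑ : Fin 3 → Literature.MathematicalPhysics.QuantumLattice.ZdEdge 4 → ℝ) (p : Plaq 4) (t : TSpace H) :
    qObsD H β ϑ p t = 1 / 2 * ∑ c, (Real.sqrt (2 * β) * sCirc (glue (pin := fun e => e ∉ dirFreeEdges H) dirCorner (2 * H + 3) (ϑ c)
        (mean (fun e => e ∉ dirFreeEdges H) dirCorner (2 * H + 3) (ϑ c))) p + dirCirc H p (t c)) ^ 2 := by
  unfold qObsD
  congr 1
  refine Finset.sum_congr rfl fun c _ => ?_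
  rw [sCirc_glue_add_ofLp, dirBackground_sdat_eq]

/-- `½Σ_c (√(2β)F̄_c)² = β·Σ_c F̄_c²` for `β ≥ 0` — the constant term of the mean core is the interface's `β·Σ_c F̄_c(x)²`. -/
theorem half_sum_sq_sdat_shift_eq {β : ℝ} (hβ : 0 ≤ β) (Fb : Fin 3 → ℝ) :
    1 / 2 * ∑ c, (Real.sqrt (2 * β) * Fb c) ^ 2 = β * ∑ c, Fb c ^ 2 := by
  have h2 : Real.sqrt (2 * β) ^ 2 = 2 * β := Real.sq_sqrt (by linarith)
  simp_rw [mul_pow, h2]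
  rw [← Finset.mul_sum]; ring

/-- `Σ_c (√(2β)F̄_c(p))(√(2β)F̄_c(q)) = 2β·Σ_c F̄_c(p)F̄_c(q)` for `β ≥ 0` — the cross term of the covariance core is the interface's
`2β(Σ_c F̄_c(p)F̄_c(q))·C_D`. -/
theorem sum_sdat_shift_mul_eq {β : ℝ} (hβ : 0 ≤ β) (Fp Fq : Fin 3 → ℝ) :
    ∑ c, (Real.sqrt (2 * β) * Fp c) * (Real.sqrt (2 * β) * Fq c) = 2 * β * ∑ c, Fp c * Fq c := by
  have h2 : Real.sqrt (2 * β) * Real.sqrt (2 * β) = 2 * β := Real.mul_self_sqrt (by linarith)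
  rw [Finset.mul_sum]
  refine Finset.sum_congr rfl fun c _ => ?_
  linear_combination (Fp c * Fq c) * h2

end Summit.QuantumFields.YangMills.Theorems.WeakCouplingRates

end
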